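import Summits.BirchSwinnertonDyer.BirchSwinnertonDyer.Theorems.KolyvaginRoadThreeSchneiderTamAtThreeHeightLogNumeratorExactPWeierstrassPoly
import Summits.BirchSwinnertonDyer.BirchSwinnertonDyer.Theorems.KolyvaginRoadThreeSchneiderTamAtThreeHeightLogNumeratorSplitDigit
import HarnessLib

/-!
# «The height is the logarithm of the numerator» — the EXACT second-order law at EVERY multiplicative
# prime `p ≥ 5`, part 3b: the scale congruence `C'² ≡ c₄ (mod p)` and the conversion `ℓ² → x⁻¹` (generic `p`)

HONEST FRAMING (cell `bsd-stepL`, seat `bsd-stepL-tam3-p2` g5, WIDTH-LEVER second lane «closed-form Schneider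
local factor … by Kodaira type (finite case table proved once)»; `--supports stmt-BirchSwinnertonDyer-19154 --as helper`):
THEOREMS ONLY, unconditional, route-independent (no Theses import); 0 definitions, 0 named facts, 0 sorry;
nothing here proves the crux `SchneiderTamAtThree`, Schneider's conjecture or BSD. `p`-generic twin of part 3a′
(`…DeepConversion`, g2) and of the scale lemmas of part 7a (g3). What is NEW at `p ≥ 5`: the conversion needs no
`b₂`-congruence of the scale (at `p = 3`: `C' ≡ b₂ (mod 3)`); instead the single congruence **`C'² ≡ c₄ (mod p)`** —
`C⁻⁴ ≡ c₆²/c₄² = c₄ − 1728Δ/c₄² (mod q)` and `p ∣ Δ` at a multiplicative prime — makes the `ℓ⁴`-coefficient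
`(6c₄ − 5b₂² − C'²)/1440 = (c₄ − b₂²)/288 + (c₄ − C'²)/1440` a `p`-adic integer although `‖1440⁻¹‖₅ = 5`. This is the
one place where the Kodaira type could have entered the second digit block of the `p`-adic height, and it does not:
the law of part 4 has precision `4k` uniformly in `I_ν`.

* §10 `norm_lambertScale_eq_one_padic`, `norm_lambertScale_sq_sub_sq_div_le_padic` (`‖(C'² − C⁻⁴)/1440‖ ≤ 1`),
  `norm_inv_scaleSq_sq_sub_c₄_le_padic` (`‖C⁻⁴ − c₄‖ ≤ p⁻¹`), `norm_lambertScale_sq_sub_c₄_le_padic` (`‖C'² − c₄‖ ≤ p⁻¹`);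
* §11 `exact_conversion_padic` — the three conversion bounds of the exact law at `p ≥ 5`.

References: [SteinWuthrich2013] §4.2; [SilvermanAEC2009] III.1, VI.3, VII.5.1; [SilvermanATAEC1994] V.3; tree: g2
`…DeepConversion`, g3 `…ExactProduct`, g4 `…SplitDigit` (`norm_inv_uniformisationScaleSq_add_le`), ui-o2
`O2ScaleTranscendence` (`norm_Δ_lt_one_of_mult`, `norm_c₆_eq_one_of_mult`), part 2a (`norm_inv_smooth_le_padic`).
-/

noncomputable section

open scoped Classical Nat
open Filter Topology IsUltrametricDist PowerSeries
open WeierstrassCurve Literature.NumberTheory.EllipticCurves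
open Literature.NumberTheory.EllipticCurves.SteinWuthrich2013
open Literature.NumberTheory.EllipticCurves.TateCurve
open Literature.NumberTheory.EllipticCurves.Rank1Residual
open Summit.BirchSwinnertonDyer.Uniform.UI.O2

namespace Summit.BirchSwinnertonDyer.Rank1Residual.X11b.RegMult.HeightLogNumerator

variable {p : ℕ} [hp : Fact p.Prime]

/-! ### §10 The corrected scale `C' = C⁻²·E₂(q)` and the congruence `C'² ≡ c₄ (mod p)` -/

section Scale

/-- **The corrected scale is a unit**: `‖C·(1 − 24K)‖ = 1` for `‖C‖ = 1`, `‖K‖ ≤ ‖q‖ < 1` (any `p`). [folklore] -/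
theorem norm_lambertScale_eq_one_padic {C K q : ℚ_[p]} (hC : ‖C‖ = 1) (hK : ‖K‖ ≤ ‖q‖) (hq : ‖q‖ < 1) :
    ‖C * (1 - 24 * K)‖ = 1 := by
  have h24 : ‖(24 : ℚ_[p])‖ ≤ 1 := by
    rw [show (24 : ℚ_[p]) = ((24 : ℤ) : ℚ_[p]) by norm_cast]; exact Padic.norm_int_le_one _
  have hlt : ‖24 * K‖ < 1 := by
    rw [norm_mul]
    calc ‖(24 : ℚ_[p])‖ * ‖K‖ ≤ 1 * ‖q‖ := by gcongr
      _ = ‖q‖ := one_mul _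
      _ < 1 := hq
  rw [norm_mul, hC, norm_one_sub_eq_one hlt, one_mul]

/-- **`‖((C(1 − 24K))² − C²)/1440‖_p ≤ 1` at `p ≥ 5`** for `‖C‖ = 1`, `‖K‖ ≤ ‖q‖ ≤ p⁻¹`:
`(C(1−24K))² − C² = −48·C²K(1 − 12K)` has norm `≤ ‖q‖ ≤ p⁻¹` and `‖1440⁻¹‖_p ≤ p` (`1440 = 2⁵·3²·5`). [folklore] -/
theorem norm_lambertScale_sq_sub_sq_div_le_padic (hp5 : 5 ≤ p) {C K q : ℚ_[p]} (hC : ‖C‖ = 1)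
    (hK : ‖K‖ ≤ ‖q‖) (hqp : ‖q‖ ≤ (p : ℝ)⁻¹) : ‖((C * (1 - 24 * K)) ^ 2 - C ^ 2) / 1440‖ ≤ 1 := by
  have hp0 : (0 : ℝ) < p := by exact_mod_cast hp.out.pos
  have h1440 : ‖(1440 : ℚ_[p])⁻¹‖ ≤ p := by
    have h := norm_inv_smooth_le_padic hp5 5 2 1; norm_num at h; rw [norm_inv]; exact h
  have h48 : ‖(48 : ℚ_[p])‖ ≤ 1 := by
    rw [show (48 : ℚ_[p]) = ((48 : ℤ) : ℚ_[p]) by norm_cast]; exact Padic.norm_int_le_one _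
  have h12 : ‖(12 : ℚ_[p])‖ ≤ 1 := by
    rw [show (12 : ℚ_[p]) = ((12 : ℤ) : ℚ_[p]) by norm_cast]; exact Padic.norm_int_le_one _
  have hq1 : ‖q‖ ≤ 1 := hqp.trans (inv_le_one_of_one_le₀ (by exact_mod_cast hp.out.one_lt.le))
  have hin : ‖1 - 12 * K‖ ≤ 1 := by
    refine (norm_sub_le_max₃ _ _).trans (max_le (by rw [norm_one]) ?_)
    rw [norm_mul]
    calc ‖(12 : ℚ_[p])‖ * ‖K‖ ≤ 1 * ‖q‖ := by gcongr
      _ ≤ 1 * 1 := by gcongr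
      _ = 1 := by norm_num
  rw [show ((C * (1 - 24 * K)) ^ 2 - C ^ 2) / 1440 = -(48 * (C ^ 2 * (K * (1 - 12 * K)))) * (1440 : ℚ_[p])⁻¹
    by ring, norm_mul, norm_neg, norm_mul, norm_mul, norm_mul, norm_pow, hC, one_pow, one_mul]
  calc ‖(48 : ℚ_[p])‖ * (‖K‖ * ‖1 - 12 * K‖) * ‖(1440 : ℚ_[p])⁻¹‖ ≤ 1 * (‖q‖ * 1) * p := by gcongr
    _ ≤ 1 * ((p : ℝ)⁻¹ * 1) * p := by gcongr
    _ = 1 := by field_simp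

variable {W : WeierstrassCurve ℚ}

/-- **`‖C⁻⁴ − c₄‖_p ≤ p⁻¹` at a multiplicative prime** (`W/ℚ` globally minimal, ANY `‖q‖_p < 1`):
`C⁻⁴ − c₄ = (C⁻² + c₆/c₄)(C⁻² − c₆/c₄) + (c₆² − c₄³)/c₄²` with `‖C⁻² + c₆/c₄‖ ≤ ‖q‖ < 1` (part `…SplitDigit`),
`c₆² − c₄³ = −1728Δ`, `‖Δ‖_p < 1`, `‖c₄‖_p = 1`; and `‖·‖ < 1 ⇒ ‖·‖ ≤ p⁻¹` in `ℚ_p`.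
[cite: SilvermanAEC2009, III.1 (`1728Δ = c₄³ − c₆²`), VII.5.1] [cite: SilvermanATAEC1994, Thm. V.3.1 (b)] -/
theorem norm_inv_scaleSq_sq_sub_c₄_le_padic [W.IsElliptic] [W.IsGloballyMinimal] (hW : Mult W p)
    {q : ℚ_[p]} (hq : ‖q‖ < 1) :
    ‖(uniformisationScaleSq W p q)⁻¹ ^ 2 - (W.c₄ : ℚ_[p])‖ ≤ (p : ℝ)⁻¹ := by
  set Ci : ℚ_[p] := (uniformisationScaleSq W p q)⁻¹ with hCi
  have h4 : ‖(W.c₄ : ℚ_[p])‖ = 1 := norm_c₄_eq_one_of_hasMultiplicativeReductionAtPrime hW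
  have h6 : ‖(W.c₆ : ℚ_[p])‖ = 1 := norm_c₆_eq_one_of_mult hW
  have hΔ : ‖(W.Δ : ℚ_[p])‖ < 1 := norm_Δ_lt_one_of_mult hW
  have hc40 : (W.c₄ : ℚ_[p]) ≠ 0 := by rw [← norm_pos_iff, h4]; exact one_pos
  have hadd : ‖Ci + (W.c₆ : ℚ_[p]) / (W.c₄ : ℚ_[p])‖ ≤ ‖q‖ := norm_inv_uniformisationScaleSq_add_le hW hq
  have hCin : ‖Ci‖ = 1 := by rw [hCi, norm_inv, norm_uniformisationScaleSq_eq_one hW hq, inv_one]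
  have hrel : ((W.c₆ : ℚ) : ℚ_[p]) ^ 2 = (W.c₄ : ℚ_[p]) ^ 3 - 1728 * (W.Δ : ℚ_[p]) := by
    have h := congrArg (fun t : ℚ => (t : ℚ_[p])) W.c_relation
    push_cast at h
    linear_combination h
  have e : Ci ^ 2 - (W.c₄ : ℚ_[p]) =
      (Ci + (W.c₆ : ℚ_[p]) / (W.c₄ : ℚ_[p])) * (Ci - (W.c₆ : ℚ_[p]) / (W.c₄ : ℚ_[p])) -
        1728 * (W.Δ : ℚ_[p]) / (W.c₄ : ℚ_[p]) ^ 2 := by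
    field_simp
    linear_combination hrel
  have hlt : ‖Ci ^ 2 - (W.c₄ : ℚ_[p])‖ < 1 := by
    rw [e]
    have h1728 : ‖(1728 : ℚ_[p])‖ ≤ 1 := by
      rw [show (1728 : ℚ_[p]) = ((1728 : ℤ) : ℚ_[p]) by norm_cast]; exact Padic.norm_int_le_one _
    have hsub : ‖Ci - (W.c₆ : ℚ_[p]) / (W.c₄ : ℚ_[p])‖ ≤ 1 :=
      (norm_sub_le_max₃ _ _).trans (max_le hCin.le (by rw [norm_div, h4, h6, div_one]))
    refine lt_of_le_of_lt (norm_sub_le_max₃ _ _) (max_lt ?_ ?_)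
    · rw [norm_mul]
      calc ‖Ci + (W.c₆ : ℚ_[p]) / (W.c₄ : ℚ_[p])‖ * ‖Ci - (W.c₆ : ℚ_[p]) / (W.c₄ : ℚ_[p])‖ ≤ ‖q‖ * 1 := by
            gcongr
        _ < 1 := by rw [mul_one]; exact hq
    · rw [norm_div, norm_mul, norm_pow, h4, one_pow, div_one]
      calc ‖(1728 : ℚ_[p])‖ * ‖(W.Δ : ℚ_[p])‖ ≤ 1 * ‖(W.Δ : ℚ_[p])‖ := by gcongr
        _ < 1 := by rw [one_mul]; exact hΔ
  exact norm_le_inv_of_norm_lt_one hlt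

/-- **`‖C'² − c₄‖_p ≤ p⁻¹`** for the corrected scale `C' = C⁻²(1 − 24K)`, `‖K‖ ≤ ‖q‖ < 1`, at a multiplicative
prime (`(1 − 24K)² − 1 = O(q)` on top of `‖C⁻⁴ − c₄‖ ≤ p⁻¹`). [folklore] -/
theorem norm_lambertScale_sq_sub_c₄_le_padic [W.IsElliptic] [W.IsGloballyMinimal] (hW : Mult W p)
    {q K : ℚ_[p]} (hq : ‖q‖ < 1) (hK : ‖K‖ ≤ ‖q‖) :
    ‖((uniformisationScaleSq W p q)⁻¹ * (1 - 24 * K)) ^ 2 - (W.c₄ : ℚ_[p])‖ ≤ (p : ℝ)⁻¹ := by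
  set Ci : ℚ_[p] := (uniformisationScaleSq W p q)⁻¹ with hCi
  have hCin : ‖Ci‖ = 1 := by rw [hCi, norm_inv, norm_uniformisationScaleSq_eq_one hW hq, inv_one]
  have hqp : ‖q‖ ≤ (p : ℝ)⁻¹ := norm_le_inv_of_norm_lt_one hq
  have h48 : ‖(48 : ℚ_[p])‖ ≤ 1 := by
    rw [show (48 : ℚ_[p]) = ((48 : ℤ) : ℚ_[p]) by norm_cast]; exact Padic.norm_int_le_one _
  have h12 : ‖(12 : ℚ_[p])‖ ≤ 1 := by
    rw [show (12 : ℚ_[p]) = ((12 : ℤ) : ℚ_[p]) by norm_cast]; exact Padic.norm_int_le_one _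
  have hin : ‖1 - 12 * K‖ ≤ 1 := by
    refine (norm_sub_le_max₃ _ _).trans (max_le (by rw [norm_one]) ?_)
    rw [norm_mul]
    calc ‖(12 : ℚ_[p])‖ * ‖K‖ ≤ 1 * ‖q‖ := by gcongr
      _ ≤ 1 * 1 := by gcongr
      _ = 1 := by norm_num
  rw [show (Ci * (1 - 24 * K)) ^ 2 - (W.c₄ : ℚ_[p]) =
    (Ci ^ 2 - (W.c₄ : ℚ_[p])) - 48 * (Ci ^ 2 * (K * (1 - 12 * K))) by ring]
  refine (norm_sub_le_max₃ _ _).trans (max_le (norm_inv_scaleSq_sq_sub_c₄_le_padic hW hq) ?_)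
  rw [norm_mul, norm_mul, norm_mul, norm_pow, hCin, one_pow, one_mul]
  calc ‖(48 : ℚ_[p])‖ * (‖K‖ * ‖1 - 12 * K‖) ≤ 1 * (‖q‖ * 1) := by gcongr
    _ = ‖q‖ := by ring
    _ ≤ (p : ℝ)⁻¹ := hqp

end Scale

/-! ### §11 The conversion `ℓ² → x⁻¹` for the exact law at `p ≥ 5` -/

section Conversion

set_option maxHeartbeats 400000 in
/-- **Conversion lemma at `p ≥ 5`.** For `x` with `‖x⁻¹‖ = r²`, `‖ℓ‖ ≤ r`, `p·r ≤ 1`, `‖b₂‖, ‖c₄‖ ≤ 1`, a corrected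
scale `C'` with `‖C'‖ = 1` and **`‖C'² − c₄‖ ≤ p⁻¹`**, and the `℘`-input `‖xℓ² − 1 + (b₂/12)ℓ² − (c₄/240)ℓ⁴‖ ≤ r⁴`:
(1) `‖(C' − b₂)/12 · (ℓ² − (x⁻¹ − (b₂/12)x⁻²))‖ ≤ r⁴`; (2) `‖(6c₄ − 5b₂² − C'²)/1440 · (ℓ⁴ − x⁻²)‖ ≤ r⁴`;
(3) `‖((6c₄ − 5b₂² − C'²)/1440 − (C' − b₂)/12·(b₂/12))·x⁻²‖ ≤ r⁴`. Key: `(6c₄ − 5b₂² − C'²)/1440 =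
(c₄ − b₂²)/288 + (c₄ − C'²)/1440` has norm `≤ 1` since `‖1440⁻¹‖_p ≤ p`. [cite: SilvermanAEC2009, VI.3] -/
theorem exact_conversion_padic (hp5 : 5 ≤ p) {X ℓ b₂ c₄ C : ℚ_[p]} {r : ℝ} (hX0 : X ≠ 0)
    (hXi2 : ‖X⁻¹‖ = r ^ 2) (hℓn : ‖ℓ‖ ≤ r) (hpr : (p : ℝ) * r ≤ 1) (hb2 : ‖b₂‖ ≤ 1) (hc4 : ‖c₄‖ ≤ 1)
    (hC1 : ‖C‖ = 1) (hCc : ‖C ^ 2 - c₄‖ ≤ (p : ℝ)⁻¹)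
    (hXℓ : ‖X * ℓ ^ 2 - 1 + b₂ / 12 * ℓ ^ 2 - c₄ / 240 * ℓ ^ 4‖ ≤ r ^ 4) :
    ‖(C - b₂) / 12 * (ℓ ^ 2 - (X⁻¹ - b₂ / 12 * X⁻¹ ^ 2))‖ ≤ r ^ 4 ∧
    ‖(6 * c₄ - 5 * b₂ ^ 2 - C ^ 2) / 1440 * (ℓ ^ 4 - X⁻¹ ^ 2)‖ ≤ r ^ 4 ∧
    ‖((6 * c₄ - 5 * b₂ ^ 2 - C ^ 2) / 1440 - (C - b₂) / 12 * (b₂ / 12)) * X⁻¹ ^ 2‖ ≤ r ^ 4 := by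
  have hp2 : p ≠ 2 := by omega
  have hp3 : p ≠ 3 := by omega
  have hp1 : (1 : ℝ) ≤ p := by exact_mod_cast hp.out.one_lt.le
  have hp0 : (0 : ℝ) < p := by positivity
  have hr0 : 0 ≤ r := le_trans (norm_nonneg _) hℓn
  have hr1 : r ≤ 1 := by nlinarith
  have hpr2 : (p : ℝ) * r ^ 2 ≤ 1 := by
    calc (p : ℝ) * r ^ 2 = ((p : ℝ) * r) * r := by ring
      _ ≤ 1 * 1 := mul_le_mul hpr hr1 hr0 zero_le_one
      _ = 1 := one_mul _
  -- units and `‖1440⁻¹‖, ‖240⁻¹‖ ≤ p`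
  have hunit : ∀ m : ℕ, Nat.Coprime p m → ‖((m : ℚ_[p]))⁻¹‖ = 1 := fun m hm => by
    rw [norm_inv, Padic.norm_natCast_eq_one_iff.mpr hm, inv_one]
  have hcop2 : Nat.Coprime p 2 := (Nat.coprime_primes hp.out Nat.prime_two).mpr hp2
  have hcop3 : Nat.Coprime p 3 := (Nat.coprime_primes hp.out Nat.prime_three).mpr hp3
  have h12i : ‖(12 : ℚ_[p])⁻¹‖ = 1 := by
    have h12 : Nat.Coprime p 12 := by
      rw [show (12 : ℕ) = 2 ^ 2 * 3 by norm_num]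
      exact (Nat.Coprime.pow_right 2 hcop2).mul_right hcop3
    simpa using hunit 12 h12
  have h288i : ‖(288 : ℚ_[p])⁻¹‖ = 1 := by
    have h288 : Nat.Coprime p 288 := by
      rw [show (288 : ℕ) = 2 ^ 5 * 3 ^ 2 by norm_num]
      exact (Nat.Coprime.pow_right 5 hcop2).mul_right (Nat.Coprime.pow_right 2 hcop3)
    simpa using hunit 288 h288
  have h5 : ‖(5 : ℚ_[p])‖ ≤ 1 := by
    rw [show (5 : ℚ_[p]) = ((5 : ℤ) : ℚ_[p]) by norm_cast]; exact Padic.norm_int_le_one _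
  have h1440 : ‖(1440 : ℚ_[p])⁻¹‖ ≤ p := by
    have h := norm_inv_smooth_le_padic hp5 5 2 1; norm_num at h; rw [norm_inv]; exact h
  have h240 : ‖(240 : ℚ_[p])⁻¹‖ ≤ p := by
    have h := norm_inv_smooth_le_padic hp5 4 1 1; norm_num at h; rw [norm_inv]; exact h
  -- the two coefficients
  have hA : ‖(C - b₂) / 12‖ ≤ 1 := by
    rw [div_eq_mul_inv, norm_mul, h12i, mul_one]
    exact (norm_sub_le_max₃ _ _).trans (max_le hC1.le hb2)
  have hB : ‖(6 * c₄ - 5 * b₂ ^ 2 - C ^ 2) / 1440‖ ≤ 1 := by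
    rw [show (6 * c₄ - 5 * b₂ ^ 2 - C ^ 2) / 1440 =
      (c₄ - b₂ ^ 2) * (288 : ℚ_[p])⁻¹ - (C ^ 2 - c₄) * (1440 : ℚ_[p])⁻¹ by ring]
    refine (norm_sub_le_max₃ _ _).trans (max_le ?_ ?_)
    · rw [norm_mul, h288i, mul_one]
      exact (norm_sub_le_max₃ _ _).trans (max_le hc4 (by rw [norm_pow]; exact pow_le_one₀ (norm_nonneg _) hb2))
    · rw [norm_mul]
      calc ‖C ^ 2 - c₄‖ * ‖(1440 : ℚ_[p])⁻¹‖ ≤ (p : ℝ)⁻¹ * p := by gcongr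
        _ = 1 := inv_mul_cancel₀ hp0.ne'
  -- `ℓ² − X⁻¹` and `ℓ² − X⁻¹ + (b₂/12)X⁻²` from the `℘`-input
  set g : ℚ_[p] := X * ℓ ^ 2 - 1 + b₂ / 12 * ℓ ^ 2 - c₄ / 240 * ℓ ^ 4 with hgdef
  have hg : ‖g‖ ≤ r ^ 4 := hXℓ
  have hb12 : ‖b₂ / 12‖ ≤ 1 := by rw [div_eq_mul_inv, norm_mul, h12i, mul_one]; exact hb2
  have hc240 : ‖c₄ / 240‖ ≤ p := by
    rw [div_eq_mul_inv, norm_mul]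
    calc ‖c₄‖ * ‖(240 : ℚ_[p])⁻¹‖ ≤ 1 * p := by gcongr
      _ = p := one_mul _
  have hℓ2 : ‖ℓ ^ 2‖ ≤ r ^ 2 := by rw [norm_pow]; exact pow_le_pow_left₀ (norm_nonneg _) hℓn 2
  have hℓ4 : ‖ℓ ^ 4‖ ≤ r ^ 4 := by rw [norm_pow]; exact pow_le_pow_left₀ (norm_nonneg _) hℓn 4
  have e1 : ℓ ^ 2 - X⁻¹ = X⁻¹ * g - b₂ / 12 * (X⁻¹ * ℓ ^ 2) + c₄ / 240 * (X⁻¹ * ℓ ^ 4) := by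
    rw [hgdef]; field_simp; ring
  have hd1 : ‖ℓ ^ 2 - X⁻¹‖ ≤ r ^ 4 := by
    rw [e1]
    refine (norm_add_le_max _ _).trans (max_le ((norm_sub_le_max₃ _ _).trans (max_le ?_ ?_)) ?_)
    · rw [norm_mul, hXi2]
      calc r ^ 2 * ‖g‖ ≤ r ^ 2 * r ^ 4 := by gcongr
        _ ≤ 1 * r ^ 4 := by gcongr; exact pow_le_one₀ hr0 hr1
        _ = r ^ 4 := one_mul _
    · rw [norm_mul, norm_mul, hXi2]
      calc ‖b₂ / 12‖ * (r ^ 2 * ‖ℓ ^ 2‖) ≤ 1 * (r ^ 2 * r ^ 2) := by gcongr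
        _ = r ^ 4 := by ring
    · rw [norm_mul, norm_mul, hXi2]
      calc ‖c₄ / 240‖ * (r ^ 2 * ‖ℓ ^ 4‖) ≤ p * (r ^ 2 * r ^ 4) := by gcongr
        _ = ((p : ℝ) * r ^ 2) * r ^ 4 := by ring
        _ ≤ 1 * r ^ 4 := by gcongr
        _ = r ^ 4 := one_mul _
  have e2 : ℓ ^ 2 - (X⁻¹ - b₂ / 12 * X⁻¹ ^ 2) =
      X⁻¹ * g - b₂ / 12 * (X⁻¹ * (ℓ ^ 2 - X⁻¹)) + c₄ / 240 * (X⁻¹ * ℓ ^ 4) := by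
    rw [hgdef]; field_simp; ring
  have hd2 : ‖ℓ ^ 2 - (X⁻¹ - b₂ / 12 * X⁻¹ ^ 2)‖ ≤ (p : ℝ) * r ^ 6 := by
    rw [e2]
    have hr6 : r ^ 6 ≤ (p : ℝ) * r ^ 6 := le_mul_of_one_le_left (by positivity) hp1
    refine (norm_add_le_max _ _).trans (max_le ((norm_sub_le_max₃ _ _).trans (max_le ?_ ?_)) ?_)
    · rw [norm_mul, hXi2]
      calc r ^ 2 * ‖g‖ ≤ r ^ 2 * r ^ 4 := by gcongr
        _ = r ^ 6 := by ring
        _ ≤ (p : ℝ) * r ^ 6 := hr6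
    · rw [norm_mul, norm_mul, hXi2]
      calc ‖b₂ / 12‖ * (r ^ 2 * ‖ℓ ^ 2 - X⁻¹‖) ≤ 1 * (r ^ 2 * r ^ 4) := by gcongr
        _ = r ^ 6 := by ring
        _ ≤ (p : ℝ) * r ^ 6 := hr6
    · rw [norm_mul, norm_mul, hXi2]
      calc ‖c₄ / 240‖ * (r ^ 2 * ‖ℓ ^ 4‖) ≤ p * (r ^ 2 * r ^ 4) := by gcongr
        _ = (p : ℝ) * r ^ 6 := by ring
  have hpr6 : (p : ℝ) * r ^ 6 ≤ r ^ 4 := by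
    calc (p : ℝ) * r ^ 6 = ((p : ℝ) * r ^ 2) * r ^ 4 := by ring
      _ ≤ 1 * r ^ 4 := by gcongr
      _ = r ^ 4 := one_mul _
  refine ⟨?_, ?_, ?_⟩
  · rw [norm_mul]
    calc ‖(C - b₂) / 12‖ * ‖ℓ ^ 2 - (X⁻¹ - b₂ / 12 * X⁻¹ ^ 2)‖ ≤ 1 * ((p : ℝ) * r ^ 6) := by gcongr
      _ ≤ r ^ 4 := by rw [one_mul]; exact hpr6
  · rw [norm_mul, show ℓ ^ 4 - X⁻¹ ^ 2 = (ℓ ^ 2 - X⁻¹) * (ℓ ^ 2 + X⁻¹) by ring, norm_mul]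
    have hplus : ‖ℓ ^ 2 + X⁻¹‖ ≤ r ^ 2 := (norm_add_le_max _ _).trans (max_le hℓ2 hXi2.le)
    calc ‖(6 * c₄ - 5 * b₂ ^ 2 - C ^ 2) / 1440‖ * (‖ℓ ^ 2 - X⁻¹‖ * ‖ℓ ^ 2 + X⁻¹‖) ≤ 1 * (r ^ 4 * r ^ 2) := by
          gcongr
      _ = r ^ 2 * r ^ 4 := by ring
      _ ≤ 1 * r ^ 4 := by gcongr; exact pow_le_one₀ hr0 hr1
      _ = r ^ 4 := one_mul _
  · rw [norm_mul, norm_pow, hXi2, show (r ^ 2) ^ 2 = r ^ 4 by ring]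
    have hco : ‖(6 * c₄ - 5 * b₂ ^ 2 - C ^ 2) / 1440 - (C - b₂) / 12 * (b₂ / 12)‖ ≤ 1 := by
      refine (norm_sub_le_max₃ _ _).trans (max_le hB ?_)
      rw [norm_mul]
      calc ‖(C - b₂) / 12‖ * ‖b₂ / 12‖ ≤ 1 * 1 := by gcongr
        _ = 1 := one_mul _
    calc _ ≤ 1 * r ^ 4 := by gcongr
      _ = r ^ 4 := one_mul _

end Conversion

end Summit.BirchSwinnertonDyer.Rank1Residual.X11b.RegMult.HeightLogNumerator

end
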